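import Summits.SmoothPoincare4.SmoothPoincare4.Theses.SmoothBijectionDefect
import Literature.Topology.FourManifolds.SchoenfliesBallForm
import Literature.Topology.FourManifolds.PalaisBallComplement
import HarnessLib.Audit

/-!
# Birth skeleton (BC3) — crux `SbdSchoenflies` (stmt-SmoothPoincare4-13498), route `SmoothBijectionDefect`

`Cruxes/SbdSchoenflies/Lines/birth.lean` · registrar planner-skel-stmt-SmoothPoincare4-13498-0 ·
2026-08-17 · mode skeleton-register (route re-audit bin REPAIRABLE).  The crux is FIXED and is
concluded BY NAME:

  `Summit.SmoothPoincare4.SmoothPoincare4.Theses.SmoothBijectionDefect.SbdSchoenflies`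

= the smooth 4-dimensional Schoenflies conjecture, equator form (every smooth embedding
`f : S³ → S⁴` is carried onto the equator `{x₄ = 0}` by a diffeomorphism of `S⁴`); verbatim the
conjecture leaf `Literature.Topology.FourManifolds.SmoothSchoenfliesConjectureFour` (Kirby list 4.32)
and SchoenfliesSplit's `SchsplitSchoenflies` (stmt-SmoothPoincare4-0372).  In the route it is
conjunct (B), "the statement that turns UNITS into standard spheres".

## The cut — through the UNIT STRATUM of the route's own defect ladder

Classically (Mazur 1959; Kirby 1989, Ch. I §6; Gabai, arXiv:2212.02004, Def. 1.3, Thm. 0.1,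
Prop. 1.9) the conjecture lives on closed manifolds: capping a closed complementary region `Δ` of a
smooth `S³ ⊂ S⁴` (a *Schoenflies ball*) with a standard disc gives a homotopy 4-sphere
`Σ_f = Δ ∪_∂ D⁴` which is a UNIT of the connected-sum monoid — in the punctured-embedding form this
route uses for units (crux `ShRigid`, SchoenfliesSplit's crux `SchsplitPuncturedEmbeds`): every
`Σ_f ∖ {q}` embeds smoothly in `ℝ⁴` — and `f` is standard iff `Σ_f ≅ S⁴`.  So the conjecture is
EXACTLY "the smooth Poincaré conjecture on the unit stratum", and the skeleton says so with typed
objects.  Two pieces of vocabulary (§0): `IsUnitSphere S` (token-identical with the per-`Σ` body of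
`ShRigid`'s conclusion) and the CAP RELATION `IsCappedBy f S` between an embedding `f : S³ → S⁴`
and a homotopy 4-sphere `S`: a smooth ball `β : ℝ⁴ ↪ S` (the cap) and a smooth open embedding
`ι : V ↪ S` of an open `V ⊇ range f` of the AMBIENT `S⁴` with `ι(range f) = β(∂𝔻⁴)` whose range
contains the whole far side `S ∖ β(𝔹⁴)` (so `ι⁻¹(S ∖ β(𝔹⁴))` is a closed side of `range f`, and `S`
is that side capped off; `IsCappedBy f S⁴` already forces `f` to be standard, §0 remark).  Stubs:

* `stub_capUnit` (KNOWN; L–XL to formalise) — every smooth `S³ ⊂ S⁴` is capped by a UNIT homotopy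
  4-sphere: `∃ S, IsUnitSphere S ∧ IsCappedBy f S` (gluing `Δ ∪_∂ D⁴`, Kervaire–Milnor 1963 §1 /
  tree `Gluing.lean`; `Δ` contractible by van Kampen + Alexander duality, tree
  `JordanBrouwerClosedHypersurface.lean`; unit: puncture at the cap centre and read `Δ ∪ collar`
  inside `S⁴ ∖ pt = ℝ⁴`, other points by homogeneity, tree `Homogeneity.lean`, or by Mazur's
  swindle in Gabai's smooth form, arXiv:2212.02004 p. 3).
* `stub_unitTwisted` (OPEN — the heart; the crux TRANSFERRED to closed manifolds) — every unit
  homotopy 4-sphere is a twisted sphere `D⁴ ∪_φ D⁴` (`IsTwistedSphere 3 φ S.carrier`, the waypoint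
  `SchsplitEveryHsphereTwisted` of route SchoenfliesSplit, here asked ONLY on the unit stratum and
  WITHOUT a Schoenflies hypothesis: it is SchoenfliesSplit's `SchsplitBridge` per `Σ` with (B)
  deleted).  Equivalent to the crux modulo theorems (⇐ crux: Bridge argument per `Σ`; ⇒ crux: this
  file), i.e. a genuine transfer `C⁺`, and the why-easier is the point of the cut: on the unit
  stratum (i) the objects form a GROUP (Gabai 2022 Prop. 1.9: Schoenflies balls / spheres /
  S-equivalence classes of `Diff₀(S¹×S³)`; inverse = complementary ball), so any homomorphism out
  of it is a tool and Gabai's Thm. 0.1 rephrases the stub as an isotopy-lifting problem in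
  `Diff₀(S¹×S³)`; (ii) THIS route's calibration applies verbatim — by the support items
  `UnitOfOnePointDefect` / `OnePointDefectOfUnit` (stmt-13499/13500) a unit is exactly a `Σ`
  reached from the round `S⁴` by a smooth bijection with ONE `C^∞`-flat defect point, so the
  route's degenerate-metric / flat-point lever bears on conjunct (B) and not only on (β);
  (iii) `Σ ∖ pt ≅ ℝ⁴` STANDARD (not an exotic `ℝ⁴`), so the whole difficulty is the germ of the
  smooth structure at one point of the one-point compactification of the standard `ℝ⁴` — the
  end-periodic / pseudo-isotopy setting of arXiv:2212.02004 §§1–2.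
* `stub_cerf` — BY NAME the route's support item `SbdCerf` (stmt-SmoothPoincare4-13502 =
  SchoenfliesSplit's `SchsplitCerf`, stmt-8758, which has its own crux lines): Cerf's `Γ₄ = 0` in
  twisted-sphere form, every `D⁴ ∪_φ D⁴` is diffeomorphic to `S⁴` (Cerf 1968; a THEOREM, tier-0
  formalisation debt XL).
* `stub_descent` (KNOWN; M–L) — standardness descends from the capped sphere: `IsCappedBy f S` and
  `S ≅ S⁴` imply `f` standard (transport the cap along `θ : S ≅ S⁴`; Palais' disc theorem in the
  ball-complement form ALREADY IN THE TREE, `hasComplementBall_of_isSmoothEmbedding`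
  (PalaisBallComplement.lean): `S⁴ ∖ θβ(𝔹⁴) = c(𝔻⁴)` for a collared ball `c` agreeing with `θβ` on
  `∂𝔻⁴`; `c(𝔻⁴) ⊆ θι(V)` by the range clause, so `(θι)⁻¹ ∘ c` (shrunk into `θι(V)`) is a smooth
  ball in the ambient `S⁴` bounded by `range f`; then equator form by
  `exists_diffeomorph_image_eq_iff_exists_ball` + `setOf_inner_eq_zero_eq_sphereFourEquator`
  (SchoenfliesBallForm.lean)).

`SbdSchoenflies_of : Sig.stub_capUnit → Sig.stub_unitTwisted → Sig.stub_cerf → Sig.stub_descent →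
SbdSchoenflies` is PROVED (§3): cap `f` by a unit `S`; the heart makes `S` a twisted sphere; Cerf
makes it `S⁴`; descent reads standardness of `f` back in the ambient sphere.  Each arrow hands over
a different typed object (unit + cap relation ↦ `IsTwistedSphere` ↦ `≃ₘ` ↦ equator), none is a
conjunction seam.  `lean check`: sorries ONLY in the four `stub_*`.

Hardest stub: `stub_unitTwisted` (open since 1959 in any form; it is (B) itself seen on closed
manifolds).  Known cases that any attack should first reproduce: Schoenflies balls with a
3-handle-free decomposition / genus ≤ 2 middle level (Scharlemann 1984), Gompf's Cappell–Shaneson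
balls (Gompf 1991).  A refutation of `stub_unitTwisted` is an exotic INVERTIBLE 4-sphere and
refutes the crux, (B) of SchoenfliesSplit, and `SmoothPoincare4` itself — informative either way.
`stub_capUnit` / `stub_descent` are theorems (their failure could only be a typing failure of
`IsCappedBy`; §0 records why the relation is tight).

BC3 probes (registrar, 2026-08-17, files `bc/probe_*.lean` of the registrar's folder): for each of
the four stub signatures `T`, `example : T → SbdSchoenflies` and `example : T → SmoothPoincare4` by
`first | exact? | simpa | aesop` FAIL (no stub is cheaply the crux or the summit; results quoted in
the registrar's NOTES.md and in the crux evidence note).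

Disproof used: none exists for this crux (`ledger crux ls stmt-SmoothPoincare4-13498`: no workfiles,
no `Disproof.lean`, no `Theorems/SbdSchoenflies/Negative/*`, 2026-08-17); negatives index of the
summit: 0 refuted statements (2026-08-17).  The refuter's crux-attack note (2026-08-15, "SURVIVES;
statement = smooth 4-dim Schoenflies, equator form, Iff.rfl-verbatim the conjecture leaf") and the
grounder's note (= `SmoothSchoenfliesConjectureFour`, open, Kirby 4.32) are honoured: the crux is
used verbatim and concluded by name; no stub is an instance of a refuted statement (there are none).

Sources: KirbyProblems1997 (Problem 4.32), Kirby1989 (Ch. I §6, PDF p. 14: ball form = equator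
form, "wide open"), Mazur1959, arXiv:2212.02004 (Gabai 2022: Def. 1.3, Thm. 0.1, Thm. 1.4,
Prop. 1.9, p. 3), arXiv:1912.09029 (Budney–Gabai, §9), Scharlemann1984, Gompf1991Killing,
CerfDiffeoSphere1968, MilnorHCobordism1965 (§9 twisted spheres), KervaireMilnorAnnals1963 (§1),
Palais1960 (Thm. B), HirschDT1976 (Ch. 8 Thm. 3.1).
-/

noncomputable section

-- every `Summit.SmoothPoincare4.SmoothPoincare4.…` name repeats the summit = sub-problem segment
-- (D-0017 layout); the duplicate is deliberate.
set_option linter.dupNamespace false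
set_option linter.unusedVariables false

namespace Summit.SmoothPoincare4.SmoothPoincare4.Cruxes.SbdSchoenflies.Birth

open scoped Manifold ContDiff Topology
open Set Function Literature.Topology.FourManifolds
open Summit.SmoothPoincare4.SmoothPoincare4.Theses.SmoothBijectionDefect (SbdSchoenflies SbdCerf)

/-- Local notation: the round `3`-sphere `S³ ⊆ ℝ⁴` (Mathlib's analytic manifold, model `𝓡 3`). -/
local notation "𝕊³" => (Metric.sphere (0 : EuclideanSpace ℝ (Fin 4)) 1)
/-- Local notation: the round `4`-sphere `S⁴ ⊆ ℝ⁵` (model `𝓡 4`), ambient sphere of the crux. -/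
local notation "𝕊⁴" => (Metric.sphere (0 : EuclideanSpace ℝ (Fin 5)) 1)
/-- Local notation: the model space `ℝ⁴`. -/
local notation "𝔼⁴" => EuclideanSpace ℝ (Fin 4)

/-! ## §0 Vocabulary — the unit stratum and the cap relation -/

/-- **`S` is a UNIT homotopy 4-sphere** (punctured-embedding form): for every point `p`, the open
submanifold `S ∖ {p}` embeds smoothly in `ℝ⁴`.  Token-identical with the per-`Σ` conclusion of this
route's crux `ShRigid` and with the per-`(Σ, p)` body of SchoenfliesSplit's crux
`SchsplitPuncturedEmbeds` (stmt-SmoothPoincare4-0371).  Classically equivalent to invertibility in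
the connected-sum monoid (`Σ # T ≅ S⁴` for some `T`) and to "`Σ = Δ ∪_∂ D⁴` for a Schoenflies ball
`Δ`" (Gabai, arXiv:2212.02004, Def. 1.3 and Prop. 1.9; Kirby 1989, Ch. I §6). -/
def IsUnitSphere (S : HomotopySphere 4) : Prop :=
  ∀ p : S.carrier, ∃ e : (⟨{p}ᶜ, isOpen_compl_singleton⟩ : TopologicalSpace.Opens S.carrier) → 𝔼⁴,
    Manifold.IsSmoothEmbedding (𝓡 4) (𝓡 4) ∞ e

/-- **The cap relation `IsCappedBy f S`** — "`S` is a closed side of `range f`, capped off by a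
standard disc": there are a smooth embedding `β : ℝ⁴ → S` (the CAP is `β(𝔻⁴)`), an open set `V` of
the ambient `S⁴` containing `range f`, and a smooth (equidimensional, hence open) embedding
`ι : V → S` such that `ι` carries `range f` onto the cap's boundary sphere `β(∂𝔻⁴)` and the range
of `ι` contains everything outside the open cap, `S ∖ β(𝔹⁴) ⊆ range ι`.  Then `ι⁻¹(S ∖ β(𝔹⁴))` is a
compact region of `S⁴` bounded by `range f` — a closed complementary region `Δ` (Schoenflies ball) —
and `S = ι(Δ) ∪ β(𝔻⁴)` glued along `β(∂𝔻⁴)`.  The relation is tight: for `S` the round sphere it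
says that `range f` bounds, inside `V`, the pull-back of the complementary ball of `β(𝔹⁴)`
(Palais), i.e. that `f` is standard; in general it is exactly what `stub_descent` consumes.
Intended witness: `S = Σ_f := Δ ∪_∂ D⁴`, `V = Δ ∪ (open collar on the other side)`,
`range ι = S ∖ β(closedBall 0 (1 - ε))`. [Mazur1959; Kirby1989 Ch. I §6; arXiv:2212.02004 Def. 1.3] -/
def IsCappedBy (f : 𝕊³ → 𝕊⁴) (S : HomotopySphere 4) : Prop :=
  ∃ (β : 𝔼⁴ → S.carrier) (V : TopologicalSpace.Opens 𝕊⁴) (ι : V → S.carrier),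
    Manifold.IsSmoothEmbedding (𝓡 4) (𝓡 4) ∞ β ∧ Manifold.IsSmoothEmbedding (𝓡 4) (𝓡 4) ∞ ι ∧
      Set.range f ⊆ (V : Set 𝕊⁴) ∧
      ι '' {x : V | (x : 𝕊⁴) ∈ Set.range f} = β '' Metric.sphere (0 : 𝔼⁴) 1 ∧
      (β '' Metric.ball (0 : 𝔼⁴) 1)ᶜ ⊆ Set.range ι

/-! ### Consistency with the route vocabulary (definitional, `Iff.rfl`) -/

/-- `IsUnitSphere` is verbatim the conclusion of the route's crux `ShRigid` for one `Σ`: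
`ShRigid ↔ ∀ S, (comparable with S⁴) → IsUnitSphere S`. -/
example : Summit.SmoothPoincare4.SmoothPoincare4.Theses.SmoothBijectionDefect.ShRigid ↔
    ∀ S : HomotopySphere 4, ((∃ f : 𝕊⁴ → S.carrier, ContMDiff (𝓡 4) (𝓡 4) ∞ f ∧ Function.Bijective f) ∨
      (∃ g : S.carrier → 𝕊⁴, ContMDiff (𝓡 4) (𝓡 4) ∞ g ∧ Function.Bijective g)) → IsUnitSphere S :=
  Iff.rfl

/-- The crux is verbatim the conjecture leaf (re-checked here; grounder g24-58, 2026-08-15). -/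
example : SbdSchoenflies ↔ Literature.Topology.FourManifolds.SmoothSchoenfliesConjectureFour :=
  Iff.rfl

/-! ## §1 The stub SIGNATURES (`Sig.stub_<name>`; the skeleton audit reads the hypotheses of
`SbdSchoenflies_of` BY NAME, heads = stub names) -/

/-- **STUB 1 — CAP-OFF GIVES A UNIT** (known mathematics; formal size L–XL).  For every smooth
embedding `f : S³ → S⁴` there is a homotopy 4-sphere `S` which is a UNIT and is a closed side of
`range f` capped off (`IsCappedBy f S`).  Construction: `Δ :=` a closed complementary region of
`range f` (smooth Jordan–Brouwer: `S⁴ ∖ range f` has two components, each closure a compact smooth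
codimension-0 submanifold bounded by `range f`; tree `JordanBrouwerClosedHypersurface.lean`,
`SchoenfliesSeparation.lean`); `Δ` is contractible (van Kampen across the simply connected `S³` and
Alexander duality); `S := Δ ∪_∂ D⁴` glued by `f` (Kervaire–Milnor 1963 §1; tree `Gluing.lean`
`exists_isBoundaryGluing`) is a closed simply connected homology 4-sphere, hence a homotopy sphere,
orientable (tree `isOrientable_of_homotopyEquiv_sphere_four_holds`).  Unit: `S ∖ {β 0}` is
`Δ ∪` (open collar) `⊆ S⁴ ∖ pt ≅ ℝ⁴` (stereographic projection); any other `p` is moved to `β 0`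
by a diffeomorphism of the connected manifold `S` (homogeneity, Palais 1960 / Hirsch 1976 Ch. 8;
tree `Homogeneity.lean`), or directly by Mazur's swindle in Gabai's smooth form
(arXiv:2212.02004, p. 3: each closed complementary region minus a point is `S³ × [0, ∞)`).
Why it might fail: only as typed (the `Opens`-subtype embedding `ι`, the `HomotopySphere`
packaging with its `SmoothOrientation` field); the mathematics is classical.
Sources: Mazur1959, KervaireMilnorAnnals1963 §1, arXiv:2212.02004 (Def. 1.3, p. 3), Palais1960,
HirschDT1976 Ch. 8, Kirby1989 Ch. I §6. -/
def Sig.stub_capUnit : Prop :=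
  ∀ f : 𝕊³ → 𝕊⁴, Manifold.IsSmoothEmbedding (𝓡 3) (𝓡 4) ∞ f →
    ∃ S : HomotopySphere 4, IsUnitSphere S ∧ IsCappedBy f S

/-- **STUB 2 — UNIT HOMOTOPY 4-SPHERES ARE TWISTED SPHERES** (OPEN — the heart; the crux
transferred to closed manifolds).  Every unit homotopy 4-sphere `S` (every `S ∖ {p}` embeds in
`ℝ⁴`) is a twisted sphere: `S = D⁴ ∪_φ D⁴` for some diffeomorphism `φ` of `S³`
(`IsTwistedSphere 3 φ S.carrier`, the body of SchoenfliesSplit's waypoint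
`SchsplitEveryHsphereTwisted` restricted to units; SchoenfliesSplit's `SchsplitBridge` per `Σ`
with its Schoenflies hypothesis removed).  STATUS: open, equivalent to the crux modulo theorems
(Cerf, Palais, Jordan–Brouwer): a unit is `Δ ∪_∂ D⁴` for a Schoenflies ball `Δ` (take a chart ball
around `p` and embed its complement by the punctured embedding), and it is twisted iff `Δ ≅ D⁴`.
WHY EASIER / what the transfer exposes: (i) GROUP STRUCTURE — units are exactly the invertible
elements and Schoenflies balls form a group under boundary connected sum, inverse = complementary
ball, isomorphic to S-equivalence classes of `Diff₀(S¹ × S³)` (Gabai, arXiv:2212.02004, Prop. 1.9;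
Thm. 0.1: the conjecture fails iff some `φ ∈ Diff₀(S¹×S³)` has `φ(x₀ × S³)` non-isotopic to
`x₀ × S³` in every finite cover), so homomorphisms out of this group and pseudo-isotopy invariants
(Hatcher–Wagoner `Σ`, loc. cit. Thm. 0.2: every such `φ` is stably isotopic to `id`) are tools
that do not exist for a general homotopy sphere; (ii) THIS ROUTE'S CALIBRATION — by the support
items `UnitOfOnePointDefect` / `OnePointDefectOfUnit` (stmt-SmoothPoincare4-13499/13500) a unit is
precisely a `Σ` reached from the round `S⁴` by a smooth bijection with a single `C^∞`-flat defect
point, so the route's degenerate-metric lever (thesis § Why this line) applies to this stub;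
(iii) `S ∖ pt` is the STANDARD `ℝ⁴`, so all exoticness is the germ at one point of a one-point
compactification of standard `ℝ⁴` (end-periodic setting).  Known cases to reproduce first:
3-handle-free / genus ≤ 2 Schoenflies balls (Scharlemann 1984), Gompf's Cappell–Shaneson balls
(Gompf 1991).  Why it might fail: an exotic invertible homotopy 4-sphere (a fake unit) refutes it —
and with it the crux, SchoenfliesSplit's (B) and `SmoothPoincare4`.
Sources: KirbyProblems1997 4.32, Kirby1989 Ch. I §6, arXiv:2212.02004, arXiv:1912.09029 §9,
Scharlemann1984, Gompf1991Killing, MilnorHCobordism1965 §9.  Size: open problem. -/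
def Sig.stub_unitTwisted : Prop :=
  ∀ [Fact (Literature.Topology.FourManifolds.isSmoothEmbedding_sphereInclusion' 3)]
    (S : HomotopySphere 4), IsUnitSphere S →
      ∃ φ : 𝕊³ ≃ₘ⟮𝓡 3, 𝓡 3⟯ 𝕊³, IsTwistedSphere 3 φ S.carrier

/-- **STUB 3 — CERF'S `Γ₄ = 0` IN TWISTED-SPHERE FORM** — BY NAME the route's support item `SbdCerf`
(stmt-SmoothPoincare4-13502; = SchoenfliesSplit's `SchsplitCerf`, stmt-SmoothPoincare4-8758; body
of the named fact `Literature.Topology.FourManifolds.cerf_twistedSphere_four`): every twisted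
4-sphere `D⁴ ∪_φ D⁴` is diffeomorphic to `S⁴`.  A THEOREM (Cerf 1968, `π₀ Diff⁺(S³) = 0`; Milnor
1965 §9), tier-0 formalisation debt of size XL, staffed through its own crux lines
(`Cruxes/SchsplitCerf/Lines/*`).  Why it might fail (as a lemma, not as mathematics): only the
`TwistedSphere` / `IsBoundaryGluing` typing.  Sources: CerfDiffeoSphere1968,
MilnorHCobordism1965 §9, KervaireMilnorAnnals1963. -/
abbrev Sig.stub_cerf : Prop :=
  SbdCerf

/-- **STUB 4 — STANDARDNESS DESCENDS FROM THE CAPPED SPHERE** (known mathematics; formal size M–L).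
If `S` is a closed side of `range f` capped off (`IsCappedBy f S`) and `S` is diffeomorphic to the
round `S⁴`, then `f` is standard.  Proof: transport `(β, V, ι)` along `θ : S ≅ S⁴`; by Palais' disc
theorem in ball-complement form (tree: `hasComplementBall_of_isSmoothEmbedding`,
PalaisBallComplement.lean) the complement `S⁴ ∖ θβ(𝔹⁴)` is `c(𝔻⁴)` for a diffeomorphism
`c : ℝ⁴ ≃ U` onto an open `U` with `c = θβ` on `∂𝔻⁴`; by the range clause of `IsCappedBy`,
`c(𝔻⁴) ⊆ θι(V)` (open), so after shrinking `c` radially into `θι(V)` the map `(θι)⁻¹ ∘ c` is a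
smooth embedding `ℝ⁴ → V ⊆ S⁴` whose unit-sphere image is `(θι)⁻¹(θβ(∂𝔻⁴)) = range f`
(injectivity of `ι` and `range f ⊆ V`); the ball form gives the equator form by
`exists_diffeomorph_image_eq_iff_exists_ball` with `setOf_inner_eq_zero_eq_sphereFourEquator`
(SchoenfliesBallForm.lean, the proof of `smoothSchoenfliesConjectureFour_iff_ballForm`).
Why it might fail: only as typed (it is the read-back lemma; its content is Palais' theorem B).
Sources: Palais1960 Thm. B, HirschDT1976 Ch. 8 Thm. 3.1, Kirby1989 Ch. I §6 (PDF p. 14). -/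
def Sig.stub_descent : Prop :=
  ∀ (f : 𝕊³ → 𝕊⁴), Manifold.IsSmoothEmbedding (𝓡 3) (𝓡 4) ∞ f → ∀ S : HomotopySphere 4,
    IsCappedBy f S → Nonempty (S.carrier ≃ₘ⟮𝓡 4, 𝓡 4⟯ 𝕊⁴) →
      ∃ φ : 𝕊⁴ ≃ₘ⟮𝓡 4, 𝓡 4⟯ 𝕊⁴, φ '' Set.range f = sphereFourEquator

/-! ## §2 The registered stubs (the ONLY `sorry`s of this file) -/

/-- Registered stub 1 (known, L–XL): cap-off gives a unit.  See `Sig.stub_capUnit`. -/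
theorem stub_capUnit : Sig.stub_capUnit := by
  sorry

/-- Registered stub 2 (OPEN, hardest, the crux's heart): unit homotopy 4-spheres are twisted
spheres.  See `Sig.stub_unitTwisted`. -/
theorem stub_unitTwisted : Sig.stub_unitTwisted := by
  sorry

/-- Registered stub 3 (theorem of Cerf, XL formalisation debt): the route's support item `SbdCerf`
by name.  See `Sig.stub_cerf`. -/
theorem stub_cerf : Sig.stub_cerf := by
  sorry

/-- Registered stub 4 (known, M–L): standardness descends from the capped sphere.  See
`Sig.stub_descent`. -/
theorem stub_descent : Sig.stub_descent := by
  sorry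

/-! ## §3 The composition — the crux BY NAME from the four stubs (real proof, no `sorry`) -/

/-- **Skeleton theorem.**  Cap-off, unit-rigidity (twisted form), Cerf and descent imply the crux
`Theses.SmoothBijectionDefect.SbdSchoenflies` BY NAME.  Fix a smooth embedding `f : S³ → S⁴`.
Stub 1 caps a closed side of `range f` off to a UNIT homotopy 4-sphere `S` (`IsCappedBy f S`);
stub 2 presents `S` as a twisted sphere `D⁴ ∪_φ D⁴`; stub 3 (Cerf) makes the twisted sphere
diffeomorphic to the round `S⁴` (the `Fact` instance `isSmoothEmbedding_sphereInclusion' 3` is the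
tree's global instance, ClosedBall.lean); stub 4 reads the standardness of `f` back in the ambient
sphere from the cap relation and that diffeomorphism. -/
theorem SbdSchoenflies_of :
    Sig.stub_capUnit → Sig.stub_unitTwisted → Sig.stub_cerf → Sig.stub_descent →
      SbdSchoenflies := by
  intro hCap hUnit hCerf hDesc f hf
  -- cap a closed side of `range f` off: a unit homotopy 4-sphere `S` with the cap relation
  obtain ⟨S, hunit, hcap⟩ := hCap f hf
  -- the heart: the unit `S` is a twisted sphere `D⁴ ∪_φ D⁴`
  obtain ⟨φ, hφ⟩ := hUnit S hunit
  -- Cerf: the twisted sphere on the carrier of `S` is diffeomorphic to the round sphere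
  have hdiff : Nonempty (S.carrier ≃ₘ⟮𝓡 4, 𝓡 4⟯ 𝕊⁴) := hCerf φ ⟨S.carrier, hφ⟩
  -- descent: standardness of `f` in the ambient `S⁴`
  exact hDesc f hf S hcap hdiff

/-- The crux by name, closed modulo the four registered stubs (its axiom closure contains `sorryAx`
through the stubs only; `SbdSchoenflies_of` itself is sorry-free). -/
theorem sbdSchoenflies_of_stubs : SbdSchoenflies :=
  SbdSchoenflies_of stub_capUnit stub_unitTwisted stub_cerf stub_descent

end Summit.SmoothPoincare4.SmoothPoincare4.Cruxes.SbdSchoenflies.Birth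

end
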